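import Literature.NumberTheory.GaloisCohomology.Howard2004.DualityDatumTateDualBridge
import Literature.NumberTheory.GaloisRepresentations.GaloisH1MapBijectiveUnramified
import Literature.NumberTheory.GaloisCohomology.PoitouTateSelmerStructures
import HarnessLib

/-!
# Howard 2004, H.4 at an unramified place: `H¹_ur` is its own exact orthogonal complement under the
# induced local pairing (from Milne I Thm. 2.6 for a family of local invariant maps)

Topic `NumberTheory/GaloisCohomology/Howard2004` (sequel to `SelmerTriples` §H4 and `DualityDatumTateDualBridge`;
theorems only; no definition, no named fact, no instance, no notation, no `sorry`).

Howard 2004, §1.3 H.4 [arXiv:1202.6340 p. 7 L78–82]: «We assume that the local condition `F` is its own exact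
orthogonal complement under the induced local pairing `⟨ , ⟩_v : H¹(K_v, T) × H¹(K_v̄, T) → R` for every finite place
`v` of `K`.»  Outside `Σ(F)` the local condition is `H¹_f = H¹_ur` (Def. 1.1.10) and the clause is Milne, *ADT*,
I Thm. 2.6 («`H¹(G/I, M)` and `H¹(G/I, M^d)` are the exact annihilators of each other») transported to Howard's
`R(1)`-valued datum.  This file proves exactly that transport, for the cell's typed objects:

* the READOUT hypothesis `hdet`: the characters `exp ∘ λ' : R(1) → μ_{p^k}` (all `ℤ_p`-semilinear `λ' : R → ℤ/p^k`)
  jointly detect `H²(K_v, R(1))`; it is named `DualityDatum.LocalTwoDetects` and derived from a finite DUALIZING family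
  `(r_i)` of `R` (`x ↦ (exp λ(r_i x))_i` bijective `R → Π_i μ_{p^k}`) in the sequel `UnramifiedSelfOrthogonalReadout.lean`
  (`DualityDatum.localTwoDetects_of_bijective`, by the tree's `twoCohomology_eq_zero_of_forall_cohomologyMap_eq_zero`).
* **`DualityDatum.isSelfOrthogonalAt_of_unramified`**: at a finite place `v ∤ p` with `T` unramified, for a
  Selmer structure whose condition at `v` is `H¹_ur(K_v, T)` and whose transported condition from `v̄` is
  `H¹_ur(K_v, Tw T)`, `D.IsSelfOrthogonalAt 𝓕 v` holds — GIVEN one family `inv : LocalInvariants K (p^k)` with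
  `inv_v` injective and `inv.UnramifiedOrthogonal` (the conjuncts `IsPerfect`, `UnramifiedOrthogonal` of the tree's named
  fact `poitouTate_selmerStructure_duality K`), the bridge data `(λ, exp)` with `Θ = D.toTateDual` bijective, and the
  readout predicate.  Mechanism: isotropy `x ∪_e y = 0` for `x ∈ H¹_ur(T)`, `y ∈ H¹_ur(Tw T)` is read character by character
  (`cohomologyMap_localCup_eq_localTatePairing`, `map_unramifiedSubgroup_le`, Milne 2.6 `⊆`, `inv_v` injective); the two
  converse inclusions are Milne 2.6 through `H¹(Θ)(H¹_ur(Tw T)) = H¹_ur(T^∨(1))` (`map_unramifiedSubgroup_eq_of_bijective`) and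
  the injectivity of `H¹(Θ)`.
* `isSelfOrthogonalAt_of_unramified_of_isPerfect` — the same with `inv.IsPerfect` in place of the injectivity of `inv_v`.

HONEST FRAMING: conditional on a family `inv` with the two printed properties (in the source: THE invariant maps of
local class field theory; the tree vendors their existence as `poitouTate_selmerStructure_duality`, not a construction);
the hypotheses «transported condition `= H¹_ur(K_v, Tw T)`» and «`Θ` bijective / dualizing family» are discharged by the
instance (cell `pub/bsd-print-x9`, D1's `eisensteinSelmerStructure` at `v ∤ pN`).  BSD is not proved by any of this.

References: [Howard2004HeegnerKolyvagin] B. Howard, *The Heegner point Kolyvagin system*, Compositio Math. 140 (2004),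
§1.1 Def. 1.1.1/1.1.6/1.1.10, §1.3 H.4 (arXiv:1202.6340 pp. 5–7); [MilneADT2006] J. S. Milne, *Arithmetic Duality
Theorems*, 2nd ed. (2006), I Cor. 2.3, Thm. 2.6; [NeukirchSchmidtWingberg2008] (7.2.15).
-/

noncomputable section

open CategoryTheory Function NumberField IsDedekindDomain Field
open scoped ContRepresentation NumberField

namespace Literature.NumberTheory.GaloisCohomology.Howard2004

open Literature.NumberTheory.GaloisRepresentations
open Literature.NumberTheory.GaloisRepresentations.DiscreteGaloisModule

variable {K : Type} [Field K] [NumberField K] {M : Type} [AddCommGroup M] [TopologicalSpace M]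
  [DiscreteTopology M] {R : Type} [CommRing R] [Module R M] [TopologicalSpace R] [DiscreteTopology R]
  {p : ℕ} [Fact p.Prime] [Algebra ℤ_[p] R] {cd : ConjugationDatum K} {ρ : DiscreteGaloisModule K M}
  (D : DualityDatum p cd ρ R) {k : ℕ}
  (lam : R →+ ZMod (p ^ k))
  (hlam : ∀ (z : ℤ_[p]) (r : R), lam (algebraMap ℤ_[p] R z * r) = PadicInt.toZModPow k z * lam r)
  (exp : ZMod (p ^ k) →+ MuCarrier K (p ^ k))
  (hexp : ∀ (g : absoluteGaloisGroup K) (x : ZMod (p ^ k)),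
    exp (cyclotomicCharacterModPow K p k g * x) = mu K (p ^ k) g (exp x))

namespace DualityDatum

/-! ## H.4 at an unramified place -/

/-- **Howard's H.4 at an unramified place `v ∤ p` (Milne I Thm. 2.6 transported to the `R(1)`-valued datum).**
Let `v ∤ p` be a finite place with `T` unramified at `v`, `𝓕` a Selmer structure with `𝓕_v = H¹_ur(K_v, T)` whose
condition at `v̄ = v^σ` transports to `H¹_ur(K_v, Tw T)`; let `inv : LocalInvariants K (p^k)` be a family with `inv_v`
injective and `UnramifiedOrthogonal` (Milne I 2.6), `(λ, exp)` bridge data with `Θ = D.toTateDual λ exp : Tw T ⥲ T^∨(1)`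
bijective, and suppose the characters `exp ∘ λ'` detect `H²(K_v, R(1))` (`hdet`).  Then `𝓕` is its own exact orthogonal complement
at `v` under the induced local pairing `H¹(K_v, T) × H¹(K_v, Tw T) → H²(K_v, R(1))` (`D.IsSelfOrthogonalAt 𝓕 v`).
[cite: Howard2004HeegnerKolyvagin, §1.3 H.4 (arXiv p. 7, L69–82) with Def. 1.1.10 (H¹_F = H¹_f off Σ)]
[cite: MilneADT2006, Ch. I, Thm. 2.6] -/
theorem isSelfOrthogonalAt_of_unramified [Finite M] (hM : ∀ m : M, (p ^ k) • m = 0)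
    (inv : LocalInvariants K (p ^ k)) (hUO : inv.UnramifiedOrthogonal) (v : HeightOneSpectrum (𝓞 K))
    (hinv : Injective (inv (Sum.inr v))) (hv : ((p : ℕ) : 𝓞 K) ∉ v.asIdeal) (hur : GaloisRep.IsUnramifiedAt v ρ)
    (hΘ : Bijective (D.toTateDual lam hlam exp hexp)) (hdet : ∀ z : galoisCohomology (D.twistOne.toLocal (Sum.inr v)) 2,
      (∀ (lam' : R →+ ZMod (p ^ k))
          (hlam' : ∀ (z : ℤ_[p]) (r : R), lam' (algebraMap ℤ_[p] R z * r) = PadicInt.toZModPow k z * lam' r),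
          cohomologyMap (D.expLamLocalHom lam' hlam' exp hexp (Sum.inr v)) 2 z = 0) → z = 0)
    (𝓕 : SelmerStructure ρ) (h𝓕 : 𝓕 (Sum.inr v) = unramifiedSubgroup (GaloisRep.toLocal v ρ) 1)
    (hFbar : (𝓕 (Sum.inr (cd.σ • v))).map (cd.transportH1 ρ v) =
      unramifiedSubgroup (GaloisRep.toLocal v (cd.twist ρ)) 1) :
    D.IsSelfOrthogonalAt 𝓕 v := by
  -- `Θ` at the place `v`
  let Θv := EllipticCurves.DiscreteGaloisModule.localMap (D.toTateDual lam hlam exp hexp) (Sum.inr v : Place K)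
  have hΘv : Bijective Θv := hΘ
  have hpk : ((p ^ k : ℕ) : 𝓞 K) ∉ v.asIdeal := fun h =>
    hv (v.isPrime.mem_of_pow_mem k (by rwa [← Nat.cast_pow]))
  obtain ⟨hUO1, hUO2⟩ := hUO ρ hM v hpk hur
  -- `H¹(Θ_v)(H¹_ur(K_v, Tw T)) = H¹_ur(K_v, T^∨(1))`
  have hW : (unramifiedSubgroup (GaloisRep.toLocal v (cd.twist ρ)) 1).map (galoisCohomology.map Θv 1) =
      unramifiedSubgroup (GaloisRep.toLocal v (ρ.tateDual (p ^ k))) 1 :=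
    galoisCohomology.map_unramifiedSubgroup_eq_of_bijective
      (τ := GaloisRep.toLocal v (cd.twist ρ)) (τ' := GaloisRep.toLocal v (ρ.tateDual (p ^ k))) Θv hΘv
  -- isotropy: unramified ∪ unramified = 0 in `H²(K_v, R(1))`, read character by character
  have iso : ∀ x ∈ unramifiedSubgroup (GaloisRep.toLocal v ρ) 1,
      ∀ y ∈ unramifiedSubgroup (GaloisRep.toLocal v (cd.twist ρ)) 1, D.localCup (Sum.inr v) x y = 0 := by
    intro x hx y hy
    refine hdet _ fun lam' hlam' => ?_
    rw [D.cohomologyMap_localCup_eq_localTatePairing lam' hlam' exp hexp]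
    have hy' : galoisCohomology.map (EllipticCurves.DiscreteGaloisModule.localMap (D.toTateDual lam' hlam' exp hexp) (Sum.inr v : Place K)) 1 y ∈
        unramifiedSubgroup (GaloisRep.toLocal v (ρ.tateDual (p ^ k))) 1 :=
      galoisCohomology.map_unramifiedSubgroup_le (τ := GaloisRep.toLocal v (cd.twist ρ))
        (τ' := GaloisRep.toLocal v (ρ.tateDual (p ^ k))) _ ⟨y, hy, rfl⟩
    have hy'' : galoisCohomology.map
          (EllipticCurves.DiscreteGaloisModule.localMap (D.toTateDual lam' hlam' exp hexp) (Sum.inr v : Place K)) 1 y ∈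
        inv.dualLocalCondition ρ (Sum.inr v) (unramifiedSubgroup (GaloisRep.toLocal v ρ) 1) := by
      rw [hUO1]; exact hy'
    have h0 : inv (Sum.inr v) (localTatePairing ρ (p ^ k) (Sum.inr v) x _) = 0 := hy'' x hx
    exact hinv (h0.trans (map_zero _).symm)
  dsimp only [IsSelfOrthogonalAt]
  rw [hFbar, h𝓕]
  refine ⟨fun x => ⟨fun hx y hy => iso x hx y hy, fun h => ?_⟩,
    fun y => ⟨fun hy x hx => iso x hx y hy, fun h => ?_⟩⟩
  · -- `x` annihilates `H¹_ur(Tw T)` ⇒ `x ∈ H¹_ur(T)` (Milne 2.6, second clause)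
    refine hUO2 x fun b hb => ?_
    rw [← hW] at hb
    obtain ⟨y, hy, rfl⟩ := hb
    rw [localTatePairingZMod_apply, ← D.cohomologyMap_localCup_eq_localTatePairing lam hlam exp hexp, h y hy]
    exact (congrArg (inv (Sum.inr v)) (map_zero _)).trans (map_zero _)
  · -- `y` annihilates `H¹_ur(T)` ⇒ `Θ_* y ∈ H¹_ur(T^∨(1)) = Θ_*(H¹_ur(Tw T))` ⇒ `y ∈ H¹_ur(Tw T)`
    have hyW : galoisCohomology.map Θv 1 y ∈
        inv.dualLocalCondition ρ (Sum.inr v) (unramifiedSubgroup (GaloisRep.toLocal v ρ) 1) :=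
      (LocalInvariants.mem_dualLocalCondition_iff _ _ _ _ _).mpr fun a ha => by
        rw [localTatePairingZMod_apply, ← D.cohomologyMap_localCup_eq_localTatePairing lam hlam exp hexp, h a ha]
        exact (congrArg (inv (Sum.inr v)) (map_zero _)).trans (map_zero _)
    rw [hUO1, ← hW] at hyW
    obtain ⟨y', hy', hyy'⟩ := hyW
    rw [← galoisCohomology.map_one_injective_of_bijective Θv hΘv hyy']
    exact hy'

/-- **H.4 at an unramified place, from `IsPerfect ∧ UnramifiedOrthogonal`** (the first and third conjuncts of the
tree's `poitouTate_selmerStructure_duality K` for the level `p^k`): as `isSelfOrthogonalAt_of_unramified`, the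
injectivity of `inv_v` being part of `IsPerfect`. [cite: Howard2004HeegnerKolyvagin, §1.3 H.4 (arXiv p. 7, L69–82)]
[cite: MilneADT2006, Ch. I, Cor. 2.3 and Thm. 2.6] -/
theorem isSelfOrthogonalAt_of_unramified_of_isPerfect [Finite M] (hM : ∀ m : M, (p ^ k) • m = 0)
    (inv : LocalInvariants K (p ^ k)) (hperf : inv.IsPerfect) (hUO : inv.UnramifiedOrthogonal)
    (v : HeightOneSpectrum (𝓞 K)) (hv : ((p : ℕ) : 𝓞 K) ∉ v.asIdeal) (hur : GaloisRep.IsUnramifiedAt v ρ)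
    (hΘ : Bijective (D.toTateDual lam hlam exp hexp)) (hdet : ∀ z : galoisCohomology (D.twistOne.toLocal (Sum.inr v)) 2,
      (∀ (lam' : R →+ ZMod (p ^ k))
          (hlam' : ∀ (z : ℤ_[p]) (r : R), lam' (algebraMap ℤ_[p] R z * r) = PadicInt.toZModPow k z * lam' r),
          cohomologyMap (D.expLamLocalHom lam' hlam' exp hexp (Sum.inr v)) 2 z = 0) → z = 0)
    (𝓕 : SelmerStructure ρ) (h𝓕 : 𝓕 (Sum.inr v) = unramifiedSubgroup (GaloisRep.toLocal v ρ) 1)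
    (hFbar : (𝓕 (Sum.inr (cd.σ • v))).map (cd.transportH1 ρ v) =
      unramifiedSubgroup (GaloisRep.toLocal v (cd.twist ρ)) 1) :
    D.IsSelfOrthogonalAt 𝓕 v :=
  D.isSelfOrthogonalAt_of_unramified lam hlam exp hexp hM inv hUO v (hperf v).1.1 hv hur hΘ hdet 𝓕 h𝓕 hFbar

end DualityDatum

end Literature.NumberTheory.GaloisCohomology.Howard2004
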